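import Mathlib.Analysis.SpecialFunctions.Exp
import Mathlib.Analysis.SpecialFunctions.Pow.Real
import Mathlib.Analysis.Complex.ExponentialBounds
import Mathlib.Algebra.Order.Floor.Defs
import HarnessLib

/-!
# W3-E (ii) `stub_effectiveFrameEnergyL_bandKill`: elementary inequalities for the choice of the ladder parameters
# (helper for K1L_D `stmt-AnomalousDissipation-27980`)

Summits-side helper file of pure real-variable lemmas (everything proved; no definitions, no named facts), used by the assembly of
the band-kill clause: `u e^{−u/α} ≤ α`; the per-level rung sums `Σ_{n<q} 3^{n+1} e^{−(((n+1)S−2Δ)−1)/(2c)} ≤ e^{−v}` when `S ≥ 4Δ+2` and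
`S/(4c) ≥ 2 + v`; the leak comparisons `2·3^{−q} ≤ e^{−t}` (`t + 1 ≤ q`) and `2/3 ≤ e^{−t}` (`t ≤ 1/3`); integer-division and floor
brackets; a weighted-sum bound. Infrastructure for route-1's rung leaf F-D1.A0 (a frontier FORMAL rung); NOT a proof of anomalous dissipation.
-/

set_option linter.dupNamespace false

namespace Summit.AnomalousDissipation.AnomalousDissipation.Theorems.SolenoidalFractalHomogenisation.LagrangianStep.LadderArith

open Finset

/-- `u e^{−u/α} ≤ α` for `α > 0` (`t ≤ e^t`). -/
theorem mul_exp_neg_div_le {u α : ℝ} (hα : 0 < α) : u * Real.exp (-(u / α)) ≤ α := by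
  have h1 : u / α ≤ Real.exp (u / α) := by have := Real.add_one_le_exp (u / α); linarith
  have h2 : u ≤ α * Real.exp (u / α) := by rwa [div_le_iff₀' hα] at h1
  rw [Real.exp_neg, mul_inv_le_iff₀ (Real.exp_pos _)]
  linarith

/-- `3 e^{−2} ≤ 1/2`. -/
theorem three_mul_exp_neg_two_le_half : 3 * Real.exp (-2 : ℝ) ≤ 1 / 2 := by
  have he : (6 : ℝ) ≤ Real.exp 2 := by
    have h1 := Real.exp_one_gt_d9
    have : Real.exp 2 = Real.exp 1 * Real.exp 1 := by rw [← Real.exp_add]; norm_num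
    rw [this]; nlinarith
  rw [Real.exp_neg, mul_inv_le_iff₀ (Real.exp_pos _)]
  linarith

/-- `Σ_{n<q} (1/2)^{n+1} ≤ 1`. -/
theorem sum_half_pow_succ_le_one (q : ℕ) : ∑ n ∈ range q, (1 / 2 : ℝ) ^ (n + 1) ≤ 1 := by
  have h : ∑ n ∈ range q, (1 / 2 : ℝ) ^ (n + 1) = 1 - (1 / 2) ^ q := by
    induction q with
    | zero => simp
    | succ q ih => rw [sum_range_succ, ih]; ring
  rw [h]
  have : 0 ≤ (1 / 2 : ℝ) ^ q := by positivity
  linarith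

/-- **Per-level rung sum, several rungs**: if `S ≥ 4Δ + 2` and `S/(4c) ≥ 2 + v` (`c > 0`, `v ≥ 0`) then
`Σ_{n<q} e^{−((((n+1)S−2Δ)−1)/2)/c} 3^{n+1} ≤ e^{−v}`. -/
theorem rung_sum_le_exp_neg {c v : ℝ} (hc : 0 < c) (hv : 0 ≤ v) {S Δ : ℕ} (hS : 4 * Δ + 2 ≤ S) (hSv : 2 + v ≤ (S : ℝ) / (4 * c))
    (q : ℕ) : ∑ n ∈ range q, Real.exp (-(((((n + 1) * S - 2 * Δ : ℕ) : ℝ) - 1) / 2 / c)) * 3 ^ (n + 1) ≤ Real.exp (-v) := by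
  have hg1 : Real.exp (-v) ≤ 1 := by rw [Real.exp_le_one_iff]; linarith
  have hg0 : 0 < Real.exp (-v) := Real.exp_pos _
  -- each term is at most `(1/2)^{n+1} e^{−v}`
  have hterm : ∀ n : ℕ, Real.exp (-(((((n + 1) * S - 2 * Δ : ℕ) : ℝ) - 1) / 2 / c)) * 3 ^ (n + 1) ≤ (1 / 2) ^ (n + 1) * Real.exp (-v) := by
    intro n
    have hle : 2 * Δ ≤ (n + 1) * S := by nlinarith
    have hcast : (((n + 1) * S - 2 * Δ : ℕ) : ℝ) = ((n : ℝ) + 1) * S - 2 * Δ := by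
      rw [Nat.cast_sub hle]; push_cast; ring
    have hS' : (4 : ℝ) * Δ + 2 ≤ S := by exact_mod_cast hS
    have hn0 : (0 : ℝ) ≤ n := Nat.cast_nonneg n
    -- exponent comparison: `(((n+1)S − 2Δ) − 1)/2/c ≥ (n+1)·S/(4c) ≥ (n+1)(2+v)`
    have h1 : ((n : ℝ) + 1) * (2 + v) ≤ ((((n + 1) * S - 2 * Δ : ℕ) : ℝ) - 1) / 2 / c := by
      rw [hcast, div_div, le_div_iff₀ (by positivity)]
      have h2 : ((n : ℝ) + 1) * (2 + v) * (2 * c) ≤ ((n : ℝ) + 1) * (S / 2) := by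
        have := mul_le_mul_of_nonneg_left hSv (by positivity : (0 : ℝ) ≤ (n + 1) * (2 * c))
        rw [show ((n : ℝ) + 1) * (2 * c) * (S / (4 * c)) = (n + 1) * (S / 2) by field_simp; ring] at this
        linarith
      nlinarith
    calc Real.exp (-(((((n + 1) * S - 2 * Δ : ℕ) : ℝ) - 1) / 2 / c)) * 3 ^ (n + 1)
        ≤ Real.exp (-(((n : ℝ) + 1) * (2 + v))) * 3 ^ (n + 1) :=
          mul_le_mul_of_nonneg_right (Real.exp_le_exp.2 (neg_le_neg h1)) (by positivity)
      _ = (3 * Real.exp (-2)) ^ (n + 1) * Real.exp (-v) ^ (n + 1) := by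
          rw [mul_pow, ← Real.exp_nat_mul, ← Real.exp_nat_mul, mul_comm (3 ^ (n + 1) : ℝ), mul_assoc, mul_comm (3 ^ (n + 1) : ℝ),
            ← mul_assoc, ← Real.exp_add]
          congr 1; push_cast; ring
      _ ≤ (1 / 2) ^ (n + 1) * Real.exp (-v) ^ (n + 1) :=
          mul_le_mul_of_nonneg_right (pow_le_pow_left₀ (by positivity) three_mul_exp_neg_two_le_half _) (by positivity)
      _ ≤ (1 / 2) ^ (n + 1) * Real.exp (-v) := by
          refine mul_le_mul_of_nonneg_left ?_ (by positivity)
          calc Real.exp (-v) ^ (n + 1) ≤ Real.exp (-v) ^ 1 := pow_le_pow_of_le_one hg0.le hg1 (by omega)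
            _ = Real.exp (-v) := pow_one _
  calc ∑ n ∈ range q, Real.exp (-(((((n + 1) * S - 2 * Δ : ℕ) : ℝ) - 1) / 2 / c)) * 3 ^ (n + 1)
      ≤ ∑ n ∈ range q, (1 / 2 : ℝ) ^ (n + 1) * Real.exp (-v) := sum_le_sum fun n _ => hterm n
    _ = (∑ n ∈ range q, (1 / 2 : ℝ) ^ (n + 1)) * Real.exp (-v) := by rw [sum_mul]
    _ ≤ 1 * Real.exp (-v) := mul_le_mul_of_nonneg_right (sum_half_pow_succ_le_one q) hg0.le
    _ = Real.exp (-v) := one_mul _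

/-- **Leak comparison, many rungs**: `2·3^{−q} ≤ e^{−t}` when `t + 1 ≤ q`. -/
theorem two_mul_inv_pow_le_exp_neg {t : ℝ} {q : ℕ} (h : t + 1 ≤ q) : 2 * (3 : ℝ)⁻¹ ^ q ≤ Real.exp (-t) := by
  have he3 : Real.exp 1 ≤ 3 := by have := Real.exp_one_lt_d9; linarith
  have he2 : (2 : ℝ) ≤ Real.exp 1 := by have := Real.exp_one_gt_d9; linarith
  -- `3^{−q} ≤ e^{−q}` and `2 ≤ e`
  have h1 : (3 : ℝ)⁻¹ ^ q ≤ Real.exp (-(q : ℝ)) := by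
    rw [inv_pow, Real.exp_neg, ← Real.exp_one_pow]
    exact inv_anti₀ (by positivity) (pow_le_pow_left₀ (by positivity) he3 q)
  calc 2 * (3 : ℝ)⁻¹ ^ q ≤ Real.exp 1 * Real.exp (-(q : ℝ)) := mul_le_mul he2 h1 (by positivity) (by positivity)
    _ = Real.exp (1 + -(q : ℝ)) := by rw [← Real.exp_add]
    _ ≤ Real.exp (-t) := Real.exp_le_exp.2 (by linarith)

/-- **Leak comparison, one rung**: `2/3 ≤ e^{−t}` when `t ≤ 1/3`. -/
theorem two_thirds_le_exp_neg {t : ℝ} (ht : t ≤ 1 / 3) : 2 / 3 ≤ Real.exp (-t) := by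
  have := Real.add_one_le_exp (-t); linarith

/-- `2 x^{−q} ≤ 2/3` for `x = 3`, `q ≥ 1`. -/
theorem two_mul_inv_pow_le_two_thirds {q : ℕ} (hq : 1 ≤ q) : 2 * (3 : ℝ)⁻¹ ^ q ≤ 2 / 3 := by
  have : (3 : ℝ)⁻¹ ^ q ≤ (3 : ℝ)⁻¹ ^ 1 := pow_le_pow_of_le_one (by norm_num) (by norm_num) hq
  rw [pow_one] at this; linarith

/-- Integer division from below, multiplicative form: `room < ⌊room/S⌋·S + S`. -/
theorem lt_nat_div_mul_add (room : ℕ) {S : ℕ} (hS : 0 < S) : (room : ℝ) < ((room / S : ℕ) : ℝ) * S + S := by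
  have h := Nat.div_add_mod room S
  have hr : ((room % S : ℕ) : ℝ) < S := by exact_mod_cast Nat.mod_lt room hS
  have : (room : ℝ) = S * ((room / S : ℕ) : ℝ) + ((room % S : ℕ) : ℝ) := by exact_mod_cast h.symm
  rw [this]; linarith

/-- Integer division from above: `⌊room/S⌋·S ≤ room` (real form). -/
theorem nat_div_mul_le (room S : ℕ) : ((room / S : ℕ) : ℝ) * S ≤ room := by
  exact_mod_cast Nat.div_mul_le_self room S

/-- The bracket `y ≤ ⌊y⌋₊ + 1 ≤ y + 1` for `y ≥ 0`. -/
theorem floor_succ_bounds {y : ℝ} (hy : 0 ≤ y) : y ≤ ((⌊y⌋₊ + 1 : ℕ) : ℝ) ∧ ((⌊y⌋₊ + 1 : ℕ) : ℝ) ≤ y + 1 := by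
  constructor
  · push_cast; exact (Nat.lt_floor_add_one y).le
  · push_cast; linarith [Nat.floor_le hy]

/-- `⌊y⌋₊ ≤ y` and `y < ⌊y⌋₊ + 1` packaged for `y ≥ 0`. -/
theorem floor_bounds {y : ℝ} (hy : 0 ≤ y) : ((⌊y⌋₊ : ℕ) : ℝ) ≤ y ∧ y < ((⌊y⌋₊ : ℕ) : ℝ) + 1 :=
  ⟨Nat.floor_le hy, Nat.lt_floor_add_one y⟩

/-- A weighted sum bound: `Σ_{i<m} w_i f_i ≤ M·B` when `0 ≤ w_i`, `f_i ≤ M`, `0 ≤ M`, `Σ w_i ≤ B`. -/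
theorem weighted_sum_le {m : ℕ} {w f : ℕ → ℝ} {M B : ℝ} (hw : ∀ i, 0 ≤ w i) (hf : ∀ i ∈ range m, f i ≤ M) (hM : 0 ≤ M)
    (hB : ∑ i ∈ range m, w i ≤ B) : ∑ i ∈ range m, w i * f i ≤ M * B := by
  calc ∑ i ∈ range m, w i * f i ≤ ∑ i ∈ range m, w i * M := sum_le_sum fun i hi => mul_le_mul_of_nonneg_left (hf i hi) (hw i)
    _ = (∑ i ∈ range m, w i) * M := by rw [sum_mul]
    _ ≤ B * M := mul_le_mul_of_nonneg_right hB hM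
    _ = M * B := mul_comm _ _

end Summit.AnomalousDissipation.AnomalousDissipation.Theorems.SolenoidalFractalHomogenisation.LagrangianStep.LadderArith
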